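import Summits.AtomisticToContinuum.BoseEinsteinCondensation.Theorems.InfraredMinimumUncertainty.Negative.LadderFrames
import Summits.AtomisticToContinuum.BoseEinsteinCondensation.Theorems.InfraredMinimumUncertainty.Negative.LadderWitness

/-!
# Negative lemmas for crux `InfraredMinimumUncertainty` (stmt-AtomisticToContinuum-11784) — XIV:
# every rung of the `fisher-gaussian-density-mode` ladder needs minimality

Supports (does not close) stmt-AtomisticToContinuum-11784 (registered gen-2 stubs `stub_phaseSteinDomination`
(FD, V/Stein form) and `stub_densityFisherGaussianity` (FG, V form); typed fallbacks DMD / FS).  Importable form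
of §H (part 6 of 6) of the cdisprove seat's standing file `Cruxes/InfraredMinimumUncertainty/Disproof.lean`
(generation 2).  All refutations are witnessed INSIDE the smooth class (`v ≡ 0`), `δ` chosen before `N`.

* `dmd_free_witness`, **`not_dmdNearMinimisers`, `dmd_false_without_minimality`** — DMD (`4N²‖k‖⁴ν ≤ C m₂`)
  is FALSE for `δ`-near-minimisers (`ν ≍ ε²`, `m₂ ≈ N‖k‖⁴`: the commutator amplitude has no Bragg part);
* `fs_free_witness`, **`not_fsNearMinimisers`, `fs_false_without_minimality`** — Feynman saturation
  `m₀ m₂ ≤ C m₁²` is FALSE for near-minimisers (`m₀ = N S` is a Bragg peak while `m₂ ≈ m₁²/N`);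
* `fdV_free_witness`, **`not_fdVNearMinimisers`, `fdV_false_without_minimality`** — FD in its REGISTERED
  V-form is FALSE for near-minimisers (`sup_φ J^V ≤ 8/N` by the AM–GM rung, `16ν ≍ ε²`): closes the
  generation-1 near-miss "FD also needs minimality" in the form now registered;
* `fgV_free_witness`, **`not_fgVNearMinimisers`, `fgV_false_without_minimality`** — the REGISTERED FG stub
  is FALSE for near-minimisers (`J^V(φ_{1/N,μ_N})·(N S) ≥ (8/3)T → ∞`);
* `rungs_of_nearMinimisers`: each near-minimiser version implies its rung — so every prover of DMD / FS /
  FD-V / FG-V must use exact minimality below every `N`-uniform energy resolution (already any slack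
  `δ_N` with `δ_N L_N² → ∞` kills).
-/

noncomputable section

open MeasureTheory Filter Set
open scoped ENNReal NNReal Topology ComplexConjugate BigOperators

namespace Summit.AtomisticToContinuum.BoseEinsteinCondensation.Theorems.InfraredMinimumUncertainty.Negative

open Literature.MathematicalPhysics.QuantumManyBody.BoseGas
open Summit.AtomisticToContinuum.BoseEinsteinCondensation.Theses.BECConjugateDomination
open Summit.AtomisticToContinuum.BoseEinsteinCondensation.Cruxes.InfraredMinimumUncertainty.FisherGaussianDensityMode
open Summit.AtomisticToContinuum.BoseEinsteinCondensation.Theorems.GaussianDominationCan.Negative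
  (prodFun contDiff_prodFun fderiv_prodFun integral_cellN_prod)
open Summit.AtomisticToContinuum.BoseEinsteinCondensation.Theorems.StaticResponseBound.Negative
  (arg re_cellWave integral_norm_sq_eq_one phiMode argCLM argCLM_apply integral_cell_trig_combo
    phiMode_sq integral_cell_phiMode_sq arg_intSMul isRepulsiveFiniteRange_zero)
open Summit.AtomisticToContinuum.BoseEinsteinCondensation.Theorems.CorrectorClosure.Negative
  (e0 e0_ne_zero sideLength_succ_pos)

/-! ### The four rungs are false without minimality -/

section Refutations

/-- DMD fails on the free near-minimisers: eventually in `N`, `4N²‖k‖⁴ν ≥ (7/2)·T·N‖k‖⁴ > 2C·N‖k‖⁴ ≥ C m₂`. [folklore] -/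
theorem dmd_free_witness {ρ : ℝ} (hρ : 0 < ρ) {δ : ℝ} (hδ : 0 < δ) {C : ℝ} (hC : 0 ≤ C) :
    ∀ᶠ n : ℕ in atTop, ∃ Ψ : PeriodicTrialState (n + 1) (sideLength ρ (n + 1)),
      periodicEnergy 0 Ψ ≤ ENNReal.ofReal δ ∧ (∀ X, Ψ.ψ X = (‖Ψ.ψ X‖ : ℂ)) ∧ (∀ X, Ψ.ψ X ≠ 0) ∧
        ¬ dmdBody C ρ n Ψ := by
  filter_upwards [eventually_lt_mul_witnessScale hρ hδ (by norm_num : (0 : ℝ) < 7 / 4) C] with n hn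
  obtain ⟨Ψ, hE, hreal, hpos, hν, _hS, _hm2l, hm2u, _hJle, _hJge⟩ :=
    ladder_free_near_minimiser_witness hρ n hδ
  refine ⟨Ψ, hE, hreal, hpos, fun hP => ?_⟩
  have h := hP e0 e0_ne_zero
  set T := min (((n : ℝ) + 1) / 16) (δ * sideLength ρ (n + 1) ^ 2 / (16 * Real.pi ^ 2)) with hT
  set N : ℝ := (n : ℝ) + 1 with hNdef
  set K4 : ℝ := ‖waveVec (sideLength ρ (n + 1)) e0‖ ^ 4 with hK4
  set ν := levyWeight n (sideLength ρ (n + 1)) Ψ e0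
  set m₂ := secondMoment (n + 1) (sideLength ρ (n + 1)) Ψ.ψ e0
  have hN : 0 < N := by positivity
  have hK40 : 0 < K4 := pow_pos (norm_waveVec_pos (sideLength_succ_pos hρ n) e0_ne_zero) 4
  have hA : 0 < N * K4 := mul_pos hN hK40
  have step1 : 4 * (N * K4) * ((7 / 8) * T) ≤ C * m₂ := by
    have e1 : 4 * N ^ 2 * K4 * ν = 4 * (N * K4) * (N * ν) := by ring
    rw [e1] at h
    exact le_trans (mul_le_mul_of_nonneg_left hν (by positivity)) h
  have step2 : C * m₂ ≤ C * (2 * N * K4) := mul_le_mul_of_nonneg_left hm2u hC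
  have hfin : (7 / 2) * T * (N * K4) ≤ 2 * C * (N * K4) := by
    have e : 4 * (N * K4) * ((7 / 8) * T) = (7 / 2) * T * (N * K4) := by ring
    have e' : C * (2 * N * K4) = 2 * C * (N * K4) := by ring
    linarith [step1, step2, e, e']
  have h72 : (7 / 2) * T ≤ 2 * C := le_of_mul_le_mul_right hfin hA
  linarith

/-- FS fails on the free near-minimisers: `(N S) m₂ ≥ 3T · N²‖k‖⁴ > C N²‖k‖⁴`. [folklore] -/
theorem fs_free_witness {ρ : ℝ} (hρ : 0 < ρ) {δ : ℝ} (hδ : 0 < δ) (C : ℝ) :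
    ∀ᶠ n : ℕ in atTop, ∃ Ψ : PeriodicTrialState (n + 1) (sideLength ρ (n + 1)),
      periodicEnergy 0 Ψ ≤ ENNReal.ofReal δ ∧ (∀ X, Ψ.ψ X = (‖Ψ.ψ X‖ : ℂ)) ∧ (∀ X, Ψ.ψ X ≠ 0) ∧
        ¬ fsBody C ρ n Ψ := by
  filter_upwards [eventually_lt_mul_witnessScale hρ hδ (by norm_num : (0 : ℝ) < 3) C] with n hn
  obtain ⟨Ψ, hE, hreal, hpos, _hν, hS, hm2l, _hm2u, _hJle, _hJge⟩ :=
    ladder_free_near_minimiser_witness hρ n hδ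
  refine ⟨Ψ, hE, hreal, hpos, fun hP => ?_⟩
  have h := hP e0 e0_ne_zero
  set T := min (((n : ℝ) + 1) / 16) (δ * sideLength ρ (n + 1) ^ 2 / (16 * Real.pi ^ 2)) with hT
  set N : ℝ := (n : ℝ) + 1 with hNdef
  set K4 : ℝ := ‖waveVec (sideLength ρ (n + 1)) e0‖ ^ 4 with hK4
  set S := structureFactor n (sideLength ρ (n + 1)) Ψ e0
  set m₂ := secondMoment (n + 1) (sideLength ρ (n + 1)) Ψ.ψ e0
  have hN : 0 < N := by positivity
  have hK40 : 0 < K4 := pow_pos (norm_waveVec_pos (sideLength_succ_pos hρ n) e0_ne_zero) 4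
  have hB : 0 < N ^ 2 * K4 := by positivity
  have hT0 : 0 ≤ T := le_min (by positivity) (by positivity)
  have step1 : (N * (3 * T)) * (N * K4) ≤ (N * S) * m₂ :=
    mul_le_mul (mul_le_mul_of_nonneg_left hS hN.le) hm2l (by positivity)
      ((mul_nonneg hN.le (by positivity)).trans (mul_le_mul_of_nonneg_left hS hN.le))
  have hfin : 3 * T * (N ^ 2 * K4) ≤ C * (N ^ 2 * K4) := by
    have e : (N * (3 * T)) * (N * K4) = 3 * T * (N ^ 2 * K4) := by ring
    linarith [step1, h, e]
  have h3 : 3 * T ≤ C := le_of_mul_le_mul_right hfin hB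
  linarith

/-- FD-V fails on the free near-minimisers: every continuous `φ` has `J^V(φ) ≤ 8/N` (AM–GM rung +
`m₂ ≤ 2N‖k‖⁴`), so `16ν ≤ C J^V(φ)` forces `14 T ≤ 16 N ν ≤ 8C`. [folklore] -/
theorem fdV_free_witness {ρ : ℝ} (hρ : 0 < ρ) {δ : ℝ} (hδ : 0 < δ) {C : ℝ} (hC : 0 ≤ C) :
    ∀ᶠ n : ℕ in atTop, ∃ Ψ : PeriodicTrialState (n + 1) (sideLength ρ (n + 1)),
      periodicEnergy 0 Ψ ≤ ENNReal.ofReal δ ∧ (∀ X, Ψ.ψ X = (‖Ψ.ψ X‖ : ℂ)) ∧ (∀ X, Ψ.ψ X ≠ 0) ∧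
        ¬ fdVBody C ρ n Ψ := by
  filter_upwards [eventually_lt_mul_witnessScale hρ hδ (by norm_num : (0 : ℝ) < 7 / 4) C] with n hn
  obtain ⟨Ψ, hE, hreal, hpos, hν, _hS, _hm2l, _hm2u, hJle, _hJge⟩ :=
    ladder_free_near_minimiser_witness hρ n hδ
  refine ⟨Ψ, hE, hreal, hpos, fun hP => ?_⟩
  obtain ⟨φ, hφ, hle⟩ := hP e0 e0_ne_zero
  set T := min (((n : ℝ) + 1) / 16) (δ * sideLength ρ (n + 1) ^ 2 / (16 * Real.pi ^ 2)) with hT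
  set N : ℝ := (n : ℝ) + 1 with hNdef
  set ν := levyWeight n (sideLength ρ (n + 1)) Ψ e0
  set J := fisherTestV n (sideLength ρ (n + 1)) Ψ e0 φ
  have hN : 0 < N := by positivity
  have a1 : 16 * ν ≤ C * (8 / N) := hle.trans (mul_le_mul_of_nonneg_left (hJle φ hφ) hC)
  have a2 : 16 * (N * ν) ≤ 8 * C := by
    have h1 := mul_le_mul_of_nonneg_left a1 hN.le
    have e : N * (C * (8 / N)) = 8 * C := by field_simp
    have e2 : N * (16 * ν) = 16 * (N * ν) := by ring
    linarith [h1, e, e2]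
  linarith [hν, a2, hn]

/-- FG-V fails on the free near-minimisers: at the centred affine field `J^V ≥ (8/9)/N` while
`N S ≥ 3NT`, so `J^V·(N S) ≥ (8/3) T > C`. [folklore] -/
theorem fgV_free_witness {ρ : ℝ} (hρ : 0 < ρ) {δ : ℝ} (hδ : 0 < δ) (C : ℝ) :
    ∀ᶠ n : ℕ in atTop, ∃ Ψ : PeriodicTrialState (n + 1) (sideLength ρ (n + 1)),
      periodicEnergy 0 Ψ ≤ ENNReal.ofReal δ ∧ (∀ X, Ψ.ψ X = (‖Ψ.ψ X‖ : ℂ)) ∧ (∀ X, Ψ.ψ X ≠ 0) ∧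
        ¬ fgVBody C ρ n Ψ := by
  filter_upwards [eventually_lt_mul_witnessScale hρ hδ (by norm_num : (0 : ℝ) < 8 / 3) C] with n hn
  obtain ⟨Ψ, hE, hreal, hpos, _hν, hS, _hm2l, _hm2u, _hJle, hJge⟩ :=
    ladder_free_near_minimiser_witness hρ n hδ
  refine ⟨Ψ, hE, hreal, hpos, fun hP => ?_⟩
  obtain ⟨φ, hφ, hJ⟩ := hJge
  have h := hP e0 e0_ne_zero φ hφ
  set T := min (((n : ℝ) + 1) / 16) (δ * sideLength ρ (n + 1) ^ 2 / (16 * Real.pi ^ 2)) with hT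
  set N : ℝ := (n : ℝ) + 1 with hNdef
  set S := structureFactor n (sideLength ρ (n + 1)) Ψ e0
  set J := fisherTestV n (sideLength ρ (n + 1)) Ψ e0 φ
  have hN : 0 < N := by positivity
  have hT0 : 0 ≤ T := le_min (by positivity) (by positivity)
  have hNS : 0 ≤ N * S := (mul_nonneg hN.le (by positivity)).trans (mul_le_mul_of_nonneg_left hS hN.le)
  have b1 : (8 / 9) / N * (N * S) ≤ J * (N * S) := mul_le_mul_of_nonneg_right hJ hNS
  have b2 : (8 / 9) / N * (N * (3 * T)) ≤ (8 / 9) / N * (N * S) :=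
    mul_le_mul_of_nonneg_left (mul_le_mul_of_nonneg_left hS hN.le) (by positivity)
  have e : (8 / 9) / N * (N * (3 * T)) = (8 / 3) * T := by field_simp; ring
  linarith [b1, b2, e, h, hn]

/-- **DMD NEEDS MINIMALITY (near-minimiser form).**  `DensityMomentDomination` with `E = E₀`
weakened to `E ≤ E₀ + δ` (`δ > 0` fixed before `N`) is FALSE (free density waves: `ν ≍ ε²`,
`m₂ ≈ N‖k‖⁴` — the commutator amplitude has no Bragg component). [folklore] -/
theorem not_dmdNearMinimisers : ¬ DensityMomentDominationNearMinimisers :=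
  not_frameNear_of_free_witness fun _ρ hρ _δ hδ _C hC => dmd_free_witness hρ hδ hC

/-- **DMD NEEDS MINIMALITY.**  `DensityMomentDomination` with the minimiser hypothesis deleted is
FALSE. [folklore] -/
theorem dmd_false_without_minimality : ¬ DensityMomentDominationWithoutMinimality :=
  not_frameWithout_of_free_witness fun _ρ hρ _δ hδ _C hC => dmd_free_witness hρ hδ hC

/-- **FEYNMAN SATURATION NEEDS MINIMALITY (near-minimiser form)**: `m₀ m₂ ≤ C m₁²` fails for
`δ`-near-minimisers (`m₀ = N S ≍ ε²N²` is a Bragg peak while `m₂ ≈ m₁²/N`). [folklore] -/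
theorem not_fsNearMinimisers : ¬ FeynmanSaturationNearMinimisers :=
  not_frameNear_of_free_witness fun _ρ hρ _δ hδ C _hC => fs_free_witness hρ hδ C

/-- **FEYNMAN SATURATION NEEDS MINIMALITY.** [folklore] -/
theorem fs_false_without_minimality : ¬ FeynmanSaturationWithoutMinimality :=
  not_frameWithout_of_free_witness fun _ρ hρ _δ hδ C _hC => fs_free_witness hρ hδ C

/-- **FD (registered V-form) NEEDS MINIMALITY (near-minimiser form)**: for `δ`-near-minimisers the
lifted Fisher information `sup_φ J^V ≤ 4m₂/(N²‖k‖⁴) = O(1/N)` (AM–GM rung) while `16ν ≍ ε²` — so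
`FisherDominationV` with `E ≤ E₀ + δ` is FALSE.  This is the generation-1 near-miss
(`FD also needs minimality`), closed in the form now registered (`stub_phaseSteinDomination` is the
Stein rewriting of this `J^V`). [folklore] -/
theorem not_fdVNearMinimisers : ¬ FisherDominationVNearMinimisers :=
  not_frameNear_of_free_witness fun _ρ hρ _δ hδ _C hC => fdV_free_witness hρ hδ hC

/-- **FD (registered V-form) NEEDS MINIMALITY.** [folklore] -/
theorem fdV_false_without_minimality : ¬ FisherDominationVWithoutMinimality :=
  not_frameWithout_of_free_witness fun _ρ hρ _δ hδ _C hC => fdV_free_witness hρ hδ hC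

/-- **FG (registered V-form, = `stub_densityFisherGaussianity`) NEEDS MINIMALITY (near-minimiser
form)**: the centred affine field gives `J^V·(N S) ≥ (8/3)·min(N/16, δL²/(16π²)) → ∞`. [folklore] -/
theorem not_fgVNearMinimisers : ¬ FisherGaussianityVNearMinimisers :=
  not_frameNear_of_free_witness fun _ρ hρ _δ hδ C _hC => fgV_free_witness hρ hδ C

/-- **FG (registered V-form) NEEDS MINIMALITY.** [folklore] -/
theorem fgV_false_without_minimality : ¬ FisherGaussianityVWithoutMinimality :=
  not_frameWithout_of_free_witness fun _ρ hρ _δ hδ C _hC => fgV_free_witness hρ hδ C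

/-- The four registered/typed rungs are STRENGTHENED by their near-minimiser versions (so the
refutations above say: any proof of DMD / FS / FD-V / FG-V must use exact minimality below every
`N`-uniform energy resolution — quantitatively below `δ_N` with `δ_N L_N² → ∞`). [folklore] -/
theorem rungs_of_nearMinimisers :
    (DensityMomentDominationNearMinimisers → DensityMomentDomination) ∧
    (FeynmanSaturationNearMinimisers → FeynmanSaturation) ∧
    (FisherDominationVNearMinimisers → FisherDominationV) ∧
    (FisherGaussianityVNearMinimisers → FisherGaussianityV) :=
  ⟨cruxFrame_of_frameNear, cruxFrame_of_frameNear, cruxFrame_of_frameNear, cruxFrame_of_frameNear⟩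

end Refutations

end Summit.AtomisticToContinuum.BoseEinsteinCondensation.Theorems.InfraredMinimumUncertainty.Negative

end
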